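import Literature.Probability.LatticeModels.PlanarIsingDiscApprox
import Literature.Analysis.Complex.RiemannMapping
import HarnessLib

/-!
# Riemann-map transport of conformally covariant families; `chi_multiPoint_rho` in printed form

`Literature.Probability.LatticeModels.chi_multiPoint_rho` (`PlanarIsingOnePoint.lean`) packages
Chelkak–Hongler–Izyurov, *Conformal invariance of spin correlations in the planar Ising model*,
Ann. of Math. (2) 181 (2015) 1087–1138 = arXiv:1202.2838 (CHI; arXiv numbering), Theorem 1.3, as:
there is a family `S : PlanarCorrFamily`, conformally covariant with exponent `1/8` between **all**
admissible domains (`IsConformallyCovariant (1/8) S`), to which the `ϱ(δ)`-normalised critical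
`+`-boundary-condition spin correlations converge on every admissible domain whose discretisations
approximate it (`MeshApproximates Ω`, CHI §2.6 / p. 13: `∂Ω_δ → ∂Ω` in the Hausdorff sense).

CHI print two clauses (Thm 1.3, p. 4 of arXiv:1202.2838), both under the standing hypothesis that
the discrete domains `Ω_δ` approximate `Ω`:

* (convergence) `ϱ(δ)^{-(k+1)/2} · 𝔼⁺_{Ω_δ}[σ_{a_0} ⋯ σ_{a_k}] → ⟨σ_{a_0} ⋯ σ_{a_k}⟩⁺_Ω` as `δ → 0`;
* (covariance, eq. (1.2))
  `⟨σ_{a_0} ⋯ σ_{a_k}⟩⁺_Ω = ⟨σ_{φ(a_0)} ⋯ σ_{φ(a_k)}⟩⁺_{Ω'} · ∏ⱼ |φ'(aⱼ)|^{1/8}` for conformal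
  `φ : Ω → Ω'`.

For the tree's *fixed* discretisation scheme not every admissible domain is approximable
(`PlanarIsingSlitDisc.lean`), so the printed theorem speaks about the limit family
`chiRhoCorr Ω n a := lim_{δ→0⁺} ϱ(δ)^{-n/2} 𝔼⁺_{Ω_δ}[σ_{a_1} ⋯ σ_{a_n}]` **between approximable
admissible domains only** (`IsConformallyCovariantOn MeshApproximates (1/8) chiRhoCorr`), whereas
`chi_multiPoint_rho` asks for a witness covariant between all admissible domains. This file proves
that the two formulations are **equivalent** (`chi_multiPoint_rho_iff`): nothing beyond CHI's
printed Theorem 1.3 (for the tree's scheme) is being asked. The only ingredient is the general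
extension theorem `isConformallyCovariantOn_iff_exists_extension`: a family covariant (exponent `Δ`)
on a class of admissible domains containing the unit disc `𝔻` agrees on that class with a family
covariant between **all** admissible domains, namely its transport along chosen Riemann maps
`ψ_Ω : Ω → 𝔻`, `riemannTransport Δ S Ω n a := ∏ᵢ |ψ_Ω'(aᵢ)|^{Δ} · S 𝔻 n (ψ_Ω ∘ a)`
(`Complex.exists_bijOn_ball_of_isSimplyConnected`, the Riemann mapping theorem of
`Literature.Analysis.Complex.RiemannMapping`; the disc is admissible,
`SlitDisc.isAdmissibleDomain_ball`, and approximable, `meshApproximates_ball`). Covariance of the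
transport between arbitrary admissible `Ω, Ω'` under `φ` is, by the chain rule for the disc
automorphism `χ = ψ_{Ω'} ∘ φ ∘ ψ_Ω⁻¹`, the covariance on the single domain `𝔻`; agreement with `S`
on the class is covariance for `ψ_Ω`.

No named fact is introduced here; `chi_multiPoint_rho` itself (CHI's theorem) is NOT proved here —
its proof is CHI §§2–3 (discrete spinor observables) and is not in the tree.

## References

* D. Chelkak, C. Hongler, K. Izyurov, Ann. of Math. (2) 181 (2015), 1087–1138; arXiv:1202.2838,
  Thm. 1.3 and eq. (1.2); §2.6 (p. 13) for the approximation convention.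
* J. B. Conway, *Functions of one complex variable I*, 2nd ed., Thm. VII.4.2 (Riemann mapping
  theorem), as proved in `Literature.Analysis.Complex.RiemannMapping`.
-/

noncomputable section

open Filter Topology Set Function
open Literature.Probability.LatticeModels

namespace Literature.Probability.LatticeModels

/-! ### Conformal covariance on a class of admissible domains -/

/-- Planar conformal covariance with scaling dimension `Δ` **restricted to the admissible domains
satisfying `P`**: for all admissible `Ω, Ω'` with `P Ω` and `P Ω'`, every conformal bijection
`φ : Ω → Ω'` and all distinct `a₁, …, aₙ ∈ Ω`,
`S Ω' n (φ a₁, …, φ aₙ) = (∏ᵢ |φ'(aᵢ)|^{-Δ}) · S Ω n (a₁, …, aₙ)`. With `P = MeshApproximates`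
this is the scope in which CHI's rule (1.2) is a statement about scaling limits of the tree's
discretisation scheme (CHI's standing hypothesis, §2 p. 13: the discrete domains approximate
`Ω`); `IsConformallyCovariant Δ S` is the case `P = ⊤` (`isConformallyCovariantOn_top`).
[cite: ChelkakHonglerIzyurovAnnals2015, Thm. 1.3 eq. (1.2) with §2 conventions] -/
def IsConformallyCovariantOn (P : Set ℂ → Prop) (Δ : ℝ) (S : PlanarCorrFamily) : Prop :=
  ∀ (Ω Ω' : Set ℂ) (φ : ℂ → ℂ), IsAdmissibleDomain Ω → P Ω → IsAdmissibleDomain Ω' → P Ω' →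
    IsConformalBijection φ Ω Ω' → ∀ n (a : Fin n → ℂ), Function.Injective a → (∀ i, a i ∈ Ω) →
      S Ω' n (fun i => φ (a i)) = (∏ i, ‖deriv φ (a i)‖ ^ (-Δ)) * S Ω n a

/-- Covariance between all admissible domains restricts to any class. [folklore] -/
theorem IsConformallyCovariant.covariantOn {Δ : ℝ} {S : PlanarCorrFamily}
    (h : IsConformallyCovariant Δ S) (P : Set ℂ → Prop) : IsConformallyCovariantOn P Δ S :=
  fun Ω Ω' φ hΩ _ hΩ' _ hφ => h Ω Ω' φ hΩ hΩ' hφ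

/-- Restricted covariance is antitone in the class. [folklore] -/
theorem IsConformallyCovariantOn.mono {P Q : Set ℂ → Prop} {Δ : ℝ} {S : PlanarCorrFamily}
    (h : IsConformallyCovariantOn P Δ S) (hQP : ∀ Ω, Q Ω → P Ω) :
    IsConformallyCovariantOn Q Δ S :=
  fun Ω Ω' φ hΩ hQ hΩ' hQ' hφ => h Ω Ω' φ hΩ (hQP Ω hQ) hΩ' (hQP Ω' hQ') hφ

/-- Covariance on the class of all admissible domains is `IsConformallyCovariant`. [folklore] -/
@[simp] theorem isConformallyCovariantOn_top {Δ : ℝ} {S : PlanarCorrFamily} :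
    IsConformallyCovariantOn (fun _ => True) Δ S ↔ IsConformallyCovariant Δ S :=
  ⟨fun h Ω Ω' φ hΩ hΩ' hφ => h Ω Ω' φ hΩ trivial hΩ' trivial hφ, fun h => h.covariantOn _⟩

/-- Restricted covariance passes to any family agreeing with a covariant one at distinct points of
the admissible domains of the class. [folklore] -/
theorem IsConformallyCovariantOn.congr {P : Set ℂ → Prop} {Δ : ℝ} {S S' : PlanarCorrFamily}
    (h : IsConformallyCovariantOn P Δ S)
    (hS : ∀ Ω, IsAdmissibleDomain Ω → P Ω → ∀ n (a : Fin n → ℂ), Function.Injective a →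
      (∀ i, a i ∈ Ω) → S' Ω n a = S Ω n a) :
    IsConformallyCovariantOn P Δ S' := by
  intro Ω Ω' φ hΩ hP hΩ' hP' hφ n a ha haΩ
  have ha' : Function.Injective fun i => φ (a i) :=
    fun i j hij => ha (hφ.2.injOn (haΩ i) (haΩ j) hij)
  rw [hS Ω hΩ hP n a ha haΩ, hS Ω' hΩ' hP' n _ ha' fun i => hφ.2.mapsTo (haΩ i)]
  exact h Ω Ω' φ hΩ hP hΩ' hP' hφ n a ha haΩ

/-! ### Riemann maps of admissible domains -/

/-- An admissible domain (open, bounded, nonempty, simply connected) admits a holomorphic bijection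
onto the unit disc with zero-free derivative and holomorphic inverse — the Riemann mapping theorem
(Conway VII.4.2) as proved in `Literature.Analysis.Complex.RiemannMapping`; a bounded set is a
proper subset of `ℂ`. [cite: Conway1978, Ch. VII Thm. 4.2] -/
theorem IsAdmissibleDomain.exists_riemannMap {Ω : Set ℂ} (hΩ : IsAdmissibleDomain Ω) :
    ∃ f : ℂ → ℂ, DifferentiableOn ℂ f Ω ∧ BijOn f Ω (Metric.ball 0 1) ∧
      (∀ z ∈ Ω, deriv f z ≠ 0) ∧ DifferentiableOn ℂ (invFunOn f Ω) (Metric.ball 0 1) := by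
  obtain ⟨hopen, hbdd, ⟨z₀, hz₀⟩, hsc⟩ := hΩ
  have hU : Ω ≠ univ := by
    rintro rfl
    exact NormedSpace.unbounded_univ ℂ ℂ hbdd
  obtain ⟨f, hd, hbij, -, hder, hinv⟩ :=
    Complex.exists_bijOn_ball_of_isSimplyConnected hopen hsc hU hz₀
  exact ⟨f, hd, hbij, hder, hinv⟩

open scoped Classical in
/-- A chosen Riemann map `ψ_Ω : Ω → 𝔻` of an admissible domain (the identity, junk, otherwise).
[cite: Conway1978, Ch. VII Thm. 4.2] -/
def riemannMapBall (Ω : Set ℂ) : ℂ → ℂ :=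
  if h : IsAdmissibleDomain Ω then Classical.choose h.exists_riemannMap else id

/-- The defining properties of the chosen Riemann map of an admissible domain: holomorphic,
bijective onto `𝔻`, zero-free derivative, holomorphic inverse `Function.invFunOn (ψ_Ω) Ω` on `𝔻`.
[cite: Conway1978, Ch. VII Thm. 4.2] -/
theorem riemannMapBall_spec {Ω : Set ℂ} (hΩ : IsAdmissibleDomain Ω) :
    DifferentiableOn ℂ (riemannMapBall Ω) Ω ∧ BijOn (riemannMapBall Ω) Ω (Metric.ball 0 1) ∧
      (∀ z ∈ Ω, deriv (riemannMapBall Ω) z ≠ 0) ∧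
      DifferentiableOn ℂ (invFunOn (riemannMapBall Ω) Ω) (Metric.ball 0 1) := by
  rw [riemannMapBall, dif_pos hΩ]
  exact Classical.choose_spec hΩ.exists_riemannMap

/-! ### The Riemann-map transport of a family and the extension theorem -/

/-- The transport of a planar family `S` from the unit disc along the chosen Riemann maps, with
exponent `Δ`: `Ω, n, a ↦ ∏ᵢ |ψ_Ω'(aᵢ)|^{Δ} · S 𝔻 n (ψ_Ω ∘ a)` — the covariance rule
`S Ω n a = S Ω' n (φ ∘ a) · ∏ᵢ |φ'(aᵢ)|^{Δ}` (CHI (1.2) for `Δ = 1/8`) read with `φ = ψ_Ω` as a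
definition, which makes sense on every admissible domain.
[cite: ChelkakHonglerIzyurovAnnals2015, Thm. 1.3 eq. (1.2)] -/
def riemannTransport (Δ : ℝ) (S : PlanarCorrFamily) : PlanarCorrFamily := fun Ω n a =>
  (∏ i, ‖deriv (riemannMapBall Ω) (a i)‖ ^ Δ) *
    S (Metric.ball 0 1) n (fun i => riemannMapBall Ω (a i))

/-- `x^{Δ} · x^{-Δ} = 1` for `x > 0`. [folklore] -/
private theorem rpow_mul_rpow_neg_self {x : ℝ} (Δ : ℝ) (hx : 0 < x) : x ^ Δ * x ^ (-Δ) = 1 := by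
  rw [← Real.rpow_add hx, add_neg_cancel, Real.rpow_zero]

/-- The exponent bookkeeping of the chain rule: for `x, z > 0` and `y ≥ 0`,
`x^{Δ} (x y z⁻¹)^{-Δ} = y^{-Δ} z^{Δ}`. [folklore] -/
private theorem rpow_chain_aux {x y z : ℝ} (Δ : ℝ) (hx : 0 < x) (hy : 0 ≤ y) (hz : 0 < z) :
    x ^ Δ * (x * y * z⁻¹) ^ (-Δ) = y ^ (-Δ) * z ^ Δ := by
  rw [Real.mul_rpow (mul_nonneg hx.le hy) (inv_nonneg.2 hz.le), Real.mul_rpow hx.le hy,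
    Real.inv_rpow hz.le, Real.rpow_neg hz.le, inv_inv]
  calc x ^ Δ * (x ^ (-Δ) * y ^ (-Δ) * z ^ Δ)
      = (x ^ Δ * x ^ (-Δ)) * (y ^ (-Δ) * z ^ Δ) := by ring
    _ = y ^ (-Δ) * z ^ Δ := by rw [rpow_mul_rpow_neg_self Δ hx, one_mul]

/-- On an admissible domain of the class, the transported family is the family itself, provided
the unit disc belongs to the class: covariance for the Riemann map `ψ_Ω : Ω → 𝔻`.
[cite: ChelkakHonglerIzyurovAnnals2015, Thm. 1.3 eq. (1.2)] -/
theorem riemannTransport_eq {P : Set ℂ → Prop} {Δ : ℝ} {S : PlanarCorrFamily}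
    (hP : P (Metric.ball 0 1)) (h : IsConformallyCovariantOn P Δ S) {Ω : Set ℂ}
    (hΩ : IsAdmissibleDomain Ω) (hPΩ : P Ω) {n : ℕ} {a : Fin n → ℂ}
    (ha : Function.Injective a) (haΩ : ∀ i, a i ∈ Ω) :
    riemannTransport Δ S Ω n a = S Ω n a := by
  obtain ⟨hdψ, hbijψ, hderψ, -⟩ := riemannMapBall_spec hΩ
  have key := h Ω (Metric.ball 0 1) (riemannMapBall Ω) hΩ hPΩ SlitDisc.isAdmissibleDomain_ball hP
    ⟨hdψ, hbijψ⟩ n a ha haΩ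
  unfold riemannTransport
  rw [key, ← mul_assoc, ← Finset.prod_mul_distrib]
  have h1 : ∏ i, ‖deriv (riemannMapBall Ω) (a i)‖ ^ Δ *
      ‖deriv (riemannMapBall Ω) (a i)‖ ^ (-Δ) = 1 :=
    Finset.prod_eq_one fun i _ => rpow_mul_rpow_neg_self Δ (norm_pos_iff.2 (hderψ _ (haΩ i)))
  rw [h1, one_mul]

/-- The transported family is conformally covariant with exponent `Δ` between **all** admissible
domains, given covariance of `S` on a class containing the unit disc: for `φ : Ω → Ω'` the
composite `χ = ψ_{Ω'} ∘ φ ∘ ψ_Ω⁻¹` is a conformal automorphism of `𝔻` with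
`χ'(ψ_Ω a) · ψ_Ω'(a) = ψ_{Ω'}'(φ a) · φ'(a)` (chain rule, holomorphic inverse of `ψ_Ω`).
[cite: ChelkakHonglerIzyurovAnnals2015, Thm. 1.3 eq. (1.2)] -/
theorem isConformallyCovariant_riemannTransport {P : Set ℂ → Prop} {Δ : ℝ} {S : PlanarCorrFamily}
    (hP : P (Metric.ball 0 1)) (h : IsConformallyCovariantOn P Δ S) :
    IsConformallyCovariant Δ (riemannTransport Δ S) := by
  intro Ω Ω' φ hΩ hΩ' hφ n a ha haΩ
  obtain ⟨hdψ, hbijψ, hderψ, hinvψ⟩ := riemannMapBall_spec hΩ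
  obtain ⟨hdψ', hbijψ', hderψ', -⟩ := riemannMapBall_spec hΩ'
  simp only [riemannTransport]
  set ψ := riemannMapBall Ω with hψ
  set ψ' := riemannMapBall Ω' with hψ'
  set g := invFunOn ψ Ω with hg
  have hopen : IsOpen Ω := hΩ.1
  have hopen' : IsOpen Ω' := hΩ'.1
  have hbijg : BijOn g (Metric.ball 0 1) Ω := hbijψ.symm hbijψ.invOn_invFunOn.symm
  have hga : ∀ i, g (ψ (a i)) = a i := fun i => hbijψ.invOn_invFunOn.1 (haΩ i)
  -- the disc automorphism `χ = ψ' ∘ φ ∘ ψ⁻¹` is a conformal bijection of `𝔻`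
  have hχconf : IsConformalBijection (fun w => ψ' (φ (g w))) (Metric.ball 0 1) (Metric.ball 0 1) :=
    ⟨(hdψ'.comp hφ.1 hφ.2.mapsTo).comp hinvψ hbijg.mapsTo, hbijψ'.comp (hφ.2.comp hbijg)⟩
  -- the marked points `ψ (a i)` of the disc
  have hbinj : Function.Injective fun i => ψ (a i) :=
    fun i j hij => ha (hbijψ.injOn (haΩ i) (haΩ j) hij)
  have hbD : ∀ i, ψ (a i) ∈ Metric.ball (0 : ℂ) 1 := fun i => hbijψ.mapsTo (haΩ i)
  have key := h (Metric.ball 0 1) (Metric.ball 0 1) (fun w => ψ' (φ (g w)))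
    SlitDisc.isAdmissibleDomain_ball hP SlitDisc.isAdmissibleDomain_ball hP hχconf n
    (fun i => ψ (a i)) hbinj hbD
  simp only [hga] at key
  -- the chain rule: `χ'(ψ a) = ψ''(φ a) · φ'(a) · ψ'(a)⁻¹`
  have hderχ : ∀ i, deriv (fun w => ψ' (φ (g w))) (ψ (a i)) =
      deriv ψ' (φ (a i)) * deriv φ (a i) * (deriv ψ (a i))⁻¹ := by
    intro i
    have h1 : HasDerivAt g (deriv ψ (a i))⁻¹ (ψ (a i)) :=
      (Complex.hasStrictDerivAt_invFunOn hopen hdψ hbijψ.injOn hderψ (haΩ i)).hasDerivAt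
    have h2 : HasDerivAt φ (deriv φ (a i)) (g (ψ (a i))) := by
      rw [hga i]
      exact (hφ.1.differentiableAt (hopen.mem_nhds (haΩ i))).hasDerivAt
    have h3 : HasDerivAt ψ' (deriv ψ' (φ (a i))) (φ (g (ψ (a i)))) := by
      rw [hga i]
      exact (hdψ'.differentiableAt (hopen'.mem_nhds (hφ.2.mapsTo (haΩ i)))).hasDerivAt
    exact ((h3.comp _ h2).comp _ h1).deriv
  -- assemble
  rw [key, ← mul_assoc, ← mul_assoc, ← Finset.prod_mul_distrib, ← Finset.prod_mul_distrib]
  congr 1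
  refine Finset.prod_congr rfl fun i _ => ?_
  rw [hderχ i, norm_mul, norm_mul, norm_inv]
  exact rpow_chain_aux Δ (norm_pos_iff.2 (hderψ' _ (hφ.2.mapsTo (haΩ i)))) (norm_nonneg _)
    (norm_pos_iff.2 (hderψ _ (haΩ i)))

/-- **Extension of conformal covariance from a class of domains containing the disc.** A planar
family is conformally covariant (exponent `Δ`) on a class `P` of admissible domains containing the
unit disc iff it agrees, at distinct points of every admissible domain of the class, with a family
that is conformally covariant between **all** admissible domains (the Riemann-map transport
`riemannTransport Δ S`). [folklore] -/
theorem isConformallyCovariantOn_iff_exists_extension {P : Set ℂ → Prop} {Δ : ℝ}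
    {S : PlanarCorrFamily} (hP : P (Metric.ball 0 1)) :
    IsConformallyCovariantOn P Δ S ↔
      ∃ S' : PlanarCorrFamily, IsConformallyCovariant Δ S' ∧
        ∀ Ω, IsAdmissibleDomain Ω → P Ω → ∀ n (a : Fin n → ℂ), Function.Injective a →
          (∀ i, a i ∈ Ω) → S' Ω n a = S Ω n a := by
  refine ⟨fun h => ⟨riemannTransport Δ S, isConformallyCovariant_riemannTransport hP h,
    fun Ω hΩ hPΩ n a ha haΩ => riemannTransport_eq hP h hΩ hPΩ ha haΩ⟩, ?_⟩
  rintro ⟨S', hS', hS'S⟩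
  exact (hS'.covariantOn P).congr fun Ω hΩ hPΩ n a ha haΩ => (hS'S Ω hΩ hPΩ n a ha haΩ).symm

/-! ### CHI Theorem 1.3: the limit family, and `chi_multiPoint_rho` in printed form -/

/-- The `ϱ`-normalised CHI scaling limit of the critical `+`-boundary-condition spin correlations,
`Ω, n, a ↦ lim_{δ → 0⁺} ϱ(δ)^{-n/2} 𝔼⁺_{Ω_δ}[σ_{a₁} ⋯ σ_{aₙ}]` (a `limUnder` along `𝓝[>] 0`;
junk-valued where the limit does not exist — by CHI Thm 1.3 it exists for admissible `Ω` with
`MeshApproximates Ω` and distinct `aᵢ ∈ Ω`). In CHI's notation this is `⟨σ_{a₁} ⋯ σ_{aₙ}⟩⁺_Ω`.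
[cite: ChelkakHonglerIzyurovAnnals2015, Thm. 1.3] -/
def chiRhoCorr : PlanarCorrFamily := fun Ω n a =>
  limUnder (𝓝[>] (0 : ℝ)) fun δ => rhoCHI δ ^ (-(n : ℝ) / 2) * meshIsingPlusCorr Ω δ a

/-- **`chi_multiPoint_rho` is CHI Theorem 1.3 as printed** (for the tree's discretisation scheme):
the packaged statement — a witness family covariant between *all* admissible domains to which the
`ϱ`-normalised correlations converge on approximable ones — is equivalent to the conjunction of
CHI's two printed clauses about approximable admissible domains: the covariance rule (1.2) for the
limit family `⟨σ_{a₁} ⋯ σ_{aₙ}⟩⁺_Ω = chiRhoCorr Ω n a` between admissible domains whose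
discretisations approximate them, and the convergence
`ϱ(δ)^{-n/2} 𝔼⁺_{Ω_δ}[σ_{a₁} ⋯ σ_{aₙ}] → ⟨σ_{a₁} ⋯ σ_{aₙ}⟩⁺_Ω` (`δ → 0⁺`) on every such domain at
distinct interior points. (`→`: the limit family agrees with the witness on approximable domains;
`←`: Riemann-map transport, `isConformallyCovariantOn_iff_exists_extension`, the unit disc being
admissible and approximable, `meshApproximates_ball`.)
[cite: ChelkakHonglerIzyurovAnnals2015, Thm. 1.3 with eq. (1.2)] -/
theorem chi_multiPoint_rho_iff :
    chi_multiPoint_rho ↔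
      IsConformallyCovariantOn MeshApproximates (1 / 8) chiRhoCorr ∧
        ∀ (Ω : Set ℂ), IsAdmissibleDomain Ω → MeshApproximates Ω → ∀ (n : ℕ) (a : Fin n → ℂ),
          Function.Injective a → (∀ i, a i ∈ Ω) →
            Tendsto (fun δ => rhoCHI δ ^ (-(n : ℝ) / 2) * meshIsingPlusCorr Ω δ a) (𝓝[>] 0)
              (𝓝 (chiRhoCorr Ω n a)) := by
  constructor
  · rintro ⟨S, hS, hlim⟩
    have hSeq : ∀ Ω, IsAdmissibleDomain Ω → MeshApproximates Ω → ∀ n (a : Fin n → ℂ),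
        Function.Injective a → (∀ i, a i ∈ Ω) → chiRhoCorr Ω n a = S Ω n a :=
      fun Ω hΩ hM n a ha haΩ => (hlim Ω hΩ hM n a ha haΩ).limUnder_eq
    refine ⟨(hS.covariantOn MeshApproximates).congr hSeq, fun Ω hΩ hM n a ha haΩ => ?_⟩
    rw [hSeq Ω hΩ hM n a ha haΩ]
    exact hlim Ω hΩ hM n a ha haΩ
  · rintro ⟨hcov, hlim⟩
    refine ⟨riemannTransport (1 / 8) chiRhoCorr,
      isConformallyCovariant_riemannTransport meshApproximates_ball hcov,
      fun Ω hΩ hM n a ha haΩ => ?_⟩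
    rw [riemannTransport_eq meshApproximates_ball hcov hΩ hM ha haΩ]
    exact hlim Ω hΩ hM n a ha haΩ

/-- The sufficient direction in the form CHI print it: if on every admissible domain whose
discretisations approximate it the `ϱ`-normalised correlations at distinct interior points have
*some* limit as `δ → 0⁺` (Thm 1.3, convergence display), and the limits obey the covariance rule
(1.2) between such domains, then `chi_multiPoint_rho` holds.
[cite: ChelkakHonglerIzyurovAnnals2015, Thm. 1.3 with eq. (1.2)] -/
theorem chi_multiPoint_rho_of_tendsto_of_covariantOn
    (h₁ : ∀ (Ω : Set ℂ), IsAdmissibleDomain Ω → MeshApproximates Ω → ∀ (n : ℕ) (a : Fin n → ℂ),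
      Function.Injective a → (∀ i, a i ∈ Ω) →
        ∃ L : ℝ, Tendsto (fun δ => rhoCHI δ ^ (-(n : ℝ) / 2) * meshIsingPlusCorr Ω δ a) (𝓝[>] 0)
          (𝓝 L))
    (h₂ : IsConformallyCovariantOn MeshApproximates (1 / 8) chiRhoCorr) : chi_multiPoint_rho :=
  chi_multiPoint_rho_iff.2
    ⟨h₂, fun Ω hΩ hM n a ha haΩ => tendsto_nhds_limUnder (h₁ Ω hΩ hM n a ha haΩ)⟩

end Literature.Probability.LatticeModels
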